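import Literature.Analysis.FluidPDE.PassiveVectorTensorEnergyDecay
import Literature.Analysis.FunctionSpaces.TorusLerayHelmholtzProofs
import HarnessLib

/-!
# Weak passive solenoidal vectors with a constant viscosity tensor: weak `L²`-continuity in time
# (continuous representatives of the pairings) and the strong `L²` initial trace

Analysis/FluidPDE proof-support file (everything proved; no definitions, no named facts). A weak
solution `w ∈ L^∞(0,T; L²(T^d))` of the class `Torus.IsWeakTensorPassiveVectorOn A T 𝔸 b w₀ w`
(`∂ₜw + (b·∇)w + A (w·∇)b + ∇π = 𝓛_𝔸 w`, `∇·w = 0`, Frisch's anisotropic eddy viscosity (9.57)) is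
determined for a.e. `t` only. Here we prove the two halves of the statement "`w ∈ C([0,T); L²_w)`
and `w(t) → w₀` strongly in `L²` as `t ↓ 0`" in the a.e. language of the class:

* `IsWeakTensorPassiveVectorOn.exists_continuousOn_integral_inner_of_isSmooth` — for a smooth
  divergence-free steady field `G` the pairing `t ↦ ∫⟪w(t), G⟫` agrees a.e. on `(0,T)` with a
  function `g` continuous on `[0,T]` with `g(0) = ∫⟪w₀, G⟫` (the absolutely continuous
  representative of `PassiveVectorTensorClass.ae_integral_inner_eq`);
* `IsWeakTensorPassiveVectorOn.exists_continuousOn_integral_inner` — **continuous representative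
  of the pairing with an `L²` test**: the same for every weakly divergence-free `φ ∈ L²(T^d; ℝ^d)`
  and an `L²` datum (`g(0) = ∫⟪w₀, φ⟫`), by density of the truncations `P_N φ` (smooth,
  divergence free) and the uniform bound `‖w(t)‖_{L²} ≤ C`: the representatives `g_N` are Cauchy
  uniformly on `[0,T]` (an a.e. bound between continuous functions holds everywhere), hence
  converge uniformly to a continuous `g`
  (De Lellis–Székelyhidi 2010, Lemma 7.1 / Appendix A; Temam 1984, Ch. III §1 Lemma 1.4);
* `IsWeakTensorPassiveVectorOn.exists_modulus_integral_norm_sq_sub` /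
  `….forall_eps_ae_integral_norm_sq_sub_le` — **strong right-continuity at `t = 0` in `L²`**
  under the energy inequality `‖w(t)‖² ≤ ‖w₀‖²` (a.e. `t`) and a weakly divergence-free `L²`
  datum: there is `ω` continuous on `[0,T]` with `ω(0) = 0` and `∫‖w(t) − w₀‖² ≤ ω(t)` for a.e.
  `t ∈ (0,T)`, equivalently `∀ ε > 0 ∃ δ > 0`, `∫‖w(t) − w₀‖² ≤ ε` for a.e. `t ∈ (0,δ)`
  (`‖w(t) − w₀‖² = ‖w(t)‖² − 2⟪w(t), w₀⟫ + ‖w₀‖² ≤ 2(‖w₀‖² − g(t))` with `g` the continuous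
  representative of `⟪w(·), w₀⟫`, `g(0) = ‖w₀‖²`; Temam 1984, Ch. III §1, proof of Thm. 1.1,
  (1.61)–(1.63): weak continuity plus the energy inequality give the strong initial trace);
* (amendment 1) `….exists_continuousOn_integral_inner_of_isSmooth'`,
  `….exists_continuousOn_integral_inner_of_memLp` — the same continuous representatives for
  ARBITRARY smooth, resp. `L²`, tests (not necessarily divergence free) when the datum `w₀` is
  weakly divergence free: by the smooth Helmholtz–Weyl decomposition `G = G₁ + ∇φ₁`
  (`TorusLerayHelmholtzProofs.smooth_helmholtz_holds`) the gradient part is invisible to `w(t)`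
  (a.e. `t`) and to `w₀`; in particular every Fourier coefficient `t ↦ 𝓕(w(t))(k)` has a
  continuous representative (weak `L²`-continuity against all of `L²`, Temam 1984 Lemma III.1.4);
* `….ae_integral_norm_sq_le`, `….exists_modulus_integral_norm_sq_sub_of_nearIso`,
  `….forall_eps_ae_integral_norm_sq_sub_le_of_nearIso` — for `A = 0`, `NearIso 𝔸 lo hi` with
  `0 < lo` and a bounded carrier the energy inequality is `PassiveVectorTensorEnergyDecay.ae_energy_ineq`,
  so the initial trace holds for EVERY weak solution of the class.

Cell `ad-ideate`, K1L `stub_cellEnergyT` clause (F) by duality (planner finding F-p4g10-1: trace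
lemmas D2 `InitialTrace`, D3 `ContinuousRepr`); the duality pairing itself is the sibling file
`PassiveVectorTensorDuality`.

## Mathlib / tree search

Tree: `PassiveVectorTensorClass.ae_integral_inner_eq` (a.e. absolutely continuous pairings with
smooth steady tests), `PassiveVectorTensorModeEnergy.integrableOn_steadyRHS`,
`PassiveVectorTensorEnergyDecay.ae_energy_ineq`, `TorusTrigPoly` (`fourierTruncate`,
`isDivFree_fourierTruncate`, `tendsto_lintegral_enorm_sq_fourierTruncate_sub`); the scalar classes
have the analogous `PassiveScalarDiagForcedTrace.exists_weaklyContinuous_representative` (built by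
the parametrised Riesz–Fischer theorem; here the representative of each pairing suffices).
Mathlib: `UniformCauchySeqOn.tendstoUniformlyOn_of_tendsto`, `TendstoUniformlyOn.continuousOn`,
`intervalIntegral.continuousOn_primitive`, `norm_sub_sq_real`.

## References

* R. Temam, *Navier–Stokes Equations*, 3rd ed. (North-Holland 1984), Ch. III §1, Lemma 1.4 and
  proof of Thm. 1.1, (1.61)–(1.63). [`Temam1984`]
* C. De Lellis, L. Székelyhidi Jr., *On admissibility criteria for weak solutions of the Euler
  equations*, Arch. Ration. Mech. Anal. 195 (2010), Lemma 7.1 / Appendix A. [`DeLellisSzekelyhidi2010`]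
* J. C. Robinson, J. L. Rodrigo, W. Sadowski, *The three-dimensional Navier–Stokes equations*
  (CUP 2016), §4.2, Lemma 4.1 and (4.20). [`RobinsonRodrigoSadowski2016`]
-/

noncomputable section

open MeasureTheory Set Filter Function TopologicalSpace Complex UnitAddTorus
open scoped ENNReal NNReal InnerProductSpace Topology ComplexConjugate

namespace Literature.Analysis.FluidPDE

namespace Torus

variable {d : Type*} [Fintype d] [DecidableEq d]

/-! ## Real-variable lemmas: a.e. bounds between continuous functions hold everywhere -/

section RealLemmas

omit [Fintype d] [DecidableEq d] in
/-- **An a.e. bound for a continuous function holds everywhere.** If `f` is continuous on `[0,T]`,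
`0 < T`, and `‖f(s)‖ ≤ c` for a.e. `s ∈ (0,T)`, then `‖f(s)‖ ≤ c` for every `s ∈ [0,T]` (an open
subinterval on which `‖f‖ > c` would have positive measure; the endpoints by closure). [folklore] -/
private theorem norm_le_of_ae_norm_le_of_continuousOn {E : Type*} [NormedAddCommGroup E] {f : ℝ → E} {T c : ℝ}
    (hT : 0 < T) (hf : ContinuousOn f (Icc 0 T))
    (h : ∀ᵐ s ∂(volume.restrict (Ioo 0 T)), ‖f s‖ ≤ c) : ∀ s ∈ Icc 0 T, ‖f s‖ ≤ c := by
  -- the bound on the open interval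
  have hopen : ∀ s ∈ Ioo 0 T, ‖f s‖ ≤ c := by
    intro s hs
    by_contra hlt
    rw [not_le] at hlt
    have hca : ContinuousAt f s := hf.continuousAt (Icc_mem_nhds hs.1 hs.2)
    have hev : ∀ᶠ y in 𝓝 s, c < ‖f y‖ := (hca.norm.eventually (lt_mem_nhds hlt))
    obtain ⟨δ, hδ, hball⟩ := Metric.eventually_nhds_iff_ball.1 (hev.and (Ioo_mem_nhds hs.1 hs.2))
    have h' : ∀ᵐ y ∂(volume : Measure ℝ), y ∈ Ioo 0 T → ‖f y‖ ≤ c := (ae_restrict_iff' measurableSet_Ioo).1 h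
    have hnull : volume {y : ℝ | ¬ (y ∈ Ioo 0 T → ‖f y‖ ≤ c)} = 0 := ae_iff.1 h'
    have hsub : Metric.ball s δ ⊆ {y : ℝ | ¬ (y ∈ Ioo 0 T → ‖f y‖ ≤ c)} := by
      intro y hy
      have := hball y hy
      simp only [mem_setOf_eq, Classical.not_imp, not_le]
      exact ⟨this.2, this.1⟩
    have h0 : volume (Metric.ball s δ) = 0 := measure_mono_null hsub hnull
    rw [Real.volume_ball] at h0
    have : (0 : ℝ≥0∞) < ENNReal.ofReal (2 * δ) := ENNReal.ofReal_pos.2 (by linarith)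
    exact this.ne' h0
  -- the endpoints by closure
  intro s hs
  have hcl : closure (Ioo (0 : ℝ) T) = Icc 0 T := closure_Ioo hT.ne
  have hfc : ContinuousOn f (closure (Ioo 0 T)) := by rwa [hcl]
  have himg : f '' closure (Ioo 0 T) ⊆ closure (f '' Ioo 0 T) := hfc.image_closure
  have hmem : f s ∈ closure (f '' Ioo 0 T) := himg ⟨s, by rwa [hcl], rfl⟩
  have hsub : f '' Ioo 0 T ⊆ Metric.closedBall (0 : E) c := by
    rintro _ ⟨y, hy, rfl⟩
    rw [Metric.mem_closedBall, dist_zero_right]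
    exact hopen y hy
  have := (closure_mono hsub) hmem
  rw [Metric.isClosed_closedBall.closure_eq, Metric.mem_closedBall, dist_zero_right] at this
  exact this

omit [Fintype d] [DecidableEq d] in
/-- **Continuous limit of continuous functions which are uniformly Cauchy almost everywhere.** Let
`F n` be continuous on `[0,T]`, `0 < T`, with `|F n(s) − F m(s)| ≤ a n + a m` for a.e. `s ∈ (0,T)`
and `a n → 0`. Then the bounds hold everywhere on `[0,T]`, so `F n` converges uniformly on `[0,T]`
to a function `g` continuous on `[0,T]`. [folklore] -/
private theorem exists_continuousOn_tendsto_of_ae_cauchy {T : ℝ} (hT : 0 < T) {F : ℕ → ℝ → ℝ} {a : ℕ → ℝ}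
    (hF : ∀ n, ContinuousOn (F n) (Icc 0 T))
    (hbd : ∀ n m, ∀ᵐ s ∂(volume.restrict (Ioo 0 T)), |F n s - F m s| ≤ a n + a m)
    (ha : Tendsto a atTop (𝓝 0)) :
    ∃ g : ℝ → ℝ, ContinuousOn g (Icc 0 T) ∧ ∀ s ∈ Icc 0 T, Tendsto (fun n => F n s) atTop (𝓝 (g s)) := by
  -- everywhere bounds
  have hev : ∀ n m, ∀ s ∈ Icc 0 T, |F n s - F m s| ≤ a n + a m := by
    intro n m
    have hc : ContinuousOn (fun s => F n s - F m s) (Icc 0 T) := (hF n).sub (hF m)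
    have h' : ∀ᵐ s ∂(volume.restrict (Ioo 0 T)), ‖F n s - F m s‖ ≤ a n + a m := by
      filter_upwards [hbd n m] with s hs
      rwa [Real.norm_eq_abs]
    intro s hs
    have := norm_le_of_ae_norm_le_of_continuousOn hT hc h' s hs
    rwa [Real.norm_eq_abs] at this
  -- uniformly Cauchy on `[0,T]`
  have hUC : UniformCauchySeqOn F atTop (Icc 0 T) := by
    rw [Metric.uniformCauchySeqOn_iff]
    intro ε hε
    have hε2 : ∀ᶠ n in atTop, |a n| < ε / 2 := by
      have := ha.abs
      rw [abs_zero] at this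
      exact this (Iio_mem_nhds (by linarith))
    obtain ⟨N, hN⟩ := eventually_atTop.1 hε2
    refine ⟨N, fun m hm n hn s hs => ?_⟩
    rw [Real.dist_eq]
    calc |F m s - F n s| ≤ a m + a n := hev m n s hs
      _ ≤ |a m| + |a n| := add_le_add (le_abs_self _) (le_abs_self _)
      _ < ε / 2 + ε / 2 := add_lt_add (hN m hm) (hN n hn)
      _ = ε := by ring
  set g : ℝ → ℝ := fun s => limUnder atTop fun n => F n s with hg
  have hpt : ∀ s ∈ Icc 0 T, Tendsto (fun n => F n s) atTop (𝓝 (g s)) := by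
    intro s hs
    have hcs : CauchySeq fun n => F n s := hUC.cauchy_map hs
    exact hcs.tendsto_limUnder
  have hunif : TendstoUniformlyOn F g atTop (Icc 0 T) := hUC.tendstoUniformlyOn_of_tendsto hpt
  exact ⟨g, hunif.continuousOn (Eventually.of_forall hF).frequently, hpt⟩

omit [Fintype d] [DecidableEq d] in
/-- Cauchy–Schwarz for pairings of `L²` fields: `|∫ ⟪a, z⟫| ≤ √(∫ ‖a‖²) · √(∫ ‖z‖²)`. [folklore] -/
private theorem abs_integral_inner_le_sqrt_mul_sqrt₉ {α : Type*} [MeasurableSpace α] {μ : Measure α}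
    {E : Type*} [NormedAddCommGroup E] [InnerProductSpace ℝ E] {a z : α → E} (ha : MemLp a 2 μ) (hz : MemLp z 2 μ) :
    |∫ x, ⟪a x, z x⟫_ℝ ∂μ| ≤ Real.sqrt (∫ x, ‖a x‖ ^ 2 ∂μ) * Real.sqrt (∫ x, ‖z x‖ ^ 2 ∂μ) := by
  have h1 : |∫ x, ⟪a x, z x⟫_ℝ ∂μ| ≤ ∫ x, ‖a x‖ * ‖z x‖ ∂μ := by
    rw [← Real.norm_eq_abs]
    refine (norm_integral_le_integral_norm _).trans (integral_mono_of_nonneg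
      (ae_of_all _ fun x => norm_nonneg _) (ha.norm.integrable_mul hz.norm)
      (ae_of_all _ fun x => norm_inner_le_norm _ _))
  have h2 := integral_mul_le_Lp_mul_Lq_of_nonneg Real.HolderConjugate.two_two
    (ae_of_all _ fun x => norm_nonneg (a x)) (ae_of_all _ fun x => norm_nonneg (z x))
    (by simpa using ha.norm) (by simpa using hz.norm)
  refine h1.trans (h2.trans_eq ?_)
  simp only [Real.rpow_two, Real.sqrt_eq_rpow]

omit [Fintype d] [DecidableEq d] in
/-- The pairing of two `L²` fields is integrable. [folklore] -/
private theorem integrable_inner_of_memLp_two₉ {α : Type*} [MeasurableSpace α] {μ : Measure α}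
    {E : Type*} [NormedAddCommGroup E] [InnerProductSpace ℝ E] {a z : α → E} (ha : MemLp a 2 μ) (hz : MemLp z 2 μ) :
    Integrable (fun x => ⟪a x, z x⟫_ℝ) μ :=
  Integrable.mono' (ha.norm.integrable_mul hz.norm) (ha.1.inner hz.1)
    (ae_of_all _ fun _ => norm_inner_le_norm _ _)

omit [Fintype d] [DecidableEq d] in
/-- `∫ ‖v‖² = (∫⁻ ‖v‖ₑ²).toReal` for `v ∈ L²`; in particular an `ℝ≥0∞` bound `∫⁻‖v‖ₑ² ≤ C` gives
`∫‖v‖² ≤ C`. [folklore] -/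
private theorem integral_norm_sq_le_of_lintegral_le₉ {α : Type*} [MeasurableSpace α] {μ : Measure α}
    {E : Type*} [NormedAddCommGroup E] {v : α → E} (hv : MemLp v 2 μ) {C : ℝ≥0}
    (h : ∫⁻ x, ‖v x‖ₑ ^ 2 ∂μ ≤ C) : ∫ x, ‖v x‖ ^ 2 ∂μ ≤ C := by
  have e : ∫⁻ x, ‖v x‖ₑ ^ 2 ∂μ = ENNReal.ofReal (∫ x, ‖v x‖ ^ 2 ∂μ) := by
    rw [ofReal_integral_eq_lintegral_ofReal (hv.integrable_norm_pow two_ne_zero) (ae_of_all _ fun x => by positivity)]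
    refine lintegral_congr_ae (ae_of_all _ fun x => ?_)
    dsimp only
    rw [ENNReal.ofReal_pow (norm_nonneg _), ofReal_norm]
  rw [e] at h
  exact (ENNReal.ofReal_le_iff_le_toReal ENNReal.coe_ne_top).1 h |>.trans_eq (ENNReal.coe_toReal C)

/-- `∫ ‖P_N φ - φ‖² → 0` for `φ ∈ L²(T^d; ℝ^d)` (Parseval tails, real form). [folklore] -/
private theorem tendsto_integral_norm_sq_fourierTruncate_sub₉
    {φ : UnitAddTorus d → EuclideanSpace ℝ d} (hφ : MemLp φ 2 volume) :
    Tendsto (fun N => ∫ x, ‖FunctionSpaces.Torus.fourierTruncate N φ x - φ x‖ ^ 2) atTop (𝓝 0) := by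
  have ht := FunctionSpaces.Torus.tendsto_lintegral_enorm_sq_fourierTruncate_sub hφ
  have hfinN : ∀ N, ∫⁻ x, ‖FunctionSpaces.Torus.fourierTruncate N φ x - φ x‖ₑ ^ 2 ≠ ⊤ := by
    intro N
    have hsub : MemLp (fun x => FunctionSpaces.Torus.fourierTruncate N φ x - φ x) 2 volume :=
      (FunctionSpaces.Torus.memLp_fourierTruncate N _ 2).sub hφ
    have h2 := lintegral_rpow_enorm_lt_top_of_eLpNorm_lt_top two_ne_zero ENNReal.ofNat_ne_top hsub.eLpNorm_lt_top
    simp only [ENNReal.toReal_ofNat, ENNReal.rpow_two] at h2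
    exact h2.ne
  have hreal := (ENNReal.tendsto_toReal ENNReal.zero_ne_top).comp ht
  rw [ENNReal.toReal_zero] at hreal
  refine hreal.congr fun N => ?_
  rw [Function.comp_apply, ← integral_toReal]
  · refine integral_congr_ae (ae_of_all _ fun x => ?_)
    dsimp only
    rw [ENNReal.toReal_pow, toReal_enorm]
  · exact (((FunctionSpaces.Torus.continuous_fourierTruncate N φ).aestronglyMeasurable.sub hφ.1).enorm.pow_const 2)
  · exact ae_of_all _ fun x => ENNReal.pow_lt_top enorm_lt_top

end RealLemmas

namespace IsWeakTensorPassiveVectorOn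

variable {A T : ℝ} {𝔸 : Visc4 d} {b w : ℝ → UnitAddTorus d → EuclideanSpace ℝ d}
  {w₀ : UnitAddTorus d → EuclideanSpace ℝ d}

/-! ## Continuous representatives of the pairings (weak `L²`-continuity in time) -/

/-- **The pairing with a smooth divergence-free steady field has a continuous representative
taking the datum value at `t = 0`.** For a weak tensor-viscosity passive-vector solution and a
smooth divergence-free `G` there is `g : ℝ → ℝ`, continuous on `[0,T]`, with `g(0) = ∫⟪w₀, G⟫` and
`∫⟪w(t), G⟫ = g(t)` for a.e. `t ∈ (0,T)` — namely
`g(t) = ∫⟪w₀, G⟫ + ∫_{(0,t]} (∫⟪w, (b·∇)G + 𝓛_𝔸^*G⟫ + A∫⟪b, (w·∇)G⟫)`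
(`PassiveVectorTensorClass.ae_integral_inner_eq`; the primitive of an integrable function is
continuous). [cite: Temam1984, Ch. III §1 Lemma 1.1 and (1.61)] -/
theorem exists_continuousOn_integral_inner_of_isSmooth (h : IsWeakTensorPassiveVectorOn A T 𝔸 b w₀ w)
    {G : UnitAddTorus d → EuclideanSpace ℝ d} (hG : FunctionSpaces.Torus.IsSmooth G)
    (hGdiv : FunctionSpaces.Torus.IsDivFree G) :
    ∃ g : ℝ → ℝ, ContinuousOn g (Icc 0 T) ∧ g 0 = ∫ x, ⟪w₀ x, G x⟫_ℝ ∧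
      ∀ᵐ t ∂(volume.restrict (Ioo 0 T)), ∫ x, ⟪w t x, G x⟫_ℝ = g t := by
  set Φ : ℝ → ℝ := fun τ =>
    (∫ x, ⟪w τ x, FunctionSpaces.Torus.convect (b τ) G x + viscAdj 𝔸 G x⟫_ℝ) +
      A * ∫ x, ⟪b τ x, FunctionSpaces.Torus.convect (w τ) G x⟫_ℝ with hΦ
  have hΦi : IntegrableOn Φ (Ioo 0 T) volume := h.integrableOn_steadyRHS hG
  have hΦI : IntegrableOn Φ (Icc 0 T) volume := (integrableOn_Icc_iff_integrableOn_Ioo (f := Φ)).2 hΦi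
  refine ⟨fun t => (∫ x, ⟪w₀ x, G x⟫_ℝ) + ∫ τ in Ioc 0 t, Φ τ, ?_, ?_, ?_⟩
  · exact continuousOn_const.add (intervalIntegral.continuousOn_primitive hΦI)
  · simp
  · filter_upwards [h.ae_integral_inner_eq hG hGdiv] with t ht
    exact ht

/-- Density passage behind the weak `L²`-continuity statements: if the pairing of `w` with
every truncation `P_N φ` of an `L²` test `φ` has a representative continuous on `[0,T]` taking the
value `∫⟪w₀, P_N φ⟫` at `0`, then so does the pairing with `φ` itself (value `∫⟪w₀, φ⟫`): by the
uniform `L²` bound of the class the representatives are uniformly Cauchy a.e., hence everywhere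
(continuity), and converge uniformly. [cite: Temam1984, Ch. III §1 Lemma 1.4] -/
private theorem exists_continuousOn_integral_inner_of_forall_fourierTruncate
    (h : IsWeakTensorPassiveVectorOn A T 𝔸 b w₀ w) (hw₀ : MemLp w₀ 2 volume)
    {φ : UnitAddTorus d → EuclideanSpace ℝ d} (hφ : MemLp φ 2 volume)
    (hrep : ∀ N : ℕ, ∃ g : ℝ → ℝ, ContinuousOn g (Icc 0 T) ∧
      g 0 = ∫ x, ⟪w₀ x, FunctionSpaces.Torus.fourierTruncate N φ x⟫_ℝ ∧
        ∀ᵐ t ∂(volume.restrict (Ioo 0 T)),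
          ∫ x, ⟪w t x, FunctionSpaces.Torus.fourierTruncate N φ x⟫_ℝ = g t) :
    ∃ g : ℝ → ℝ, ContinuousOn g (Icc 0 T) ∧ g 0 = ∫ x, ⟪w₀ x, φ x⟫_ℝ ∧
      ∀ᵐ t ∂(volume.restrict (Ioo 0 T)), ∫ x, ⟪w t x, φ x⟫_ℝ = g t := by
  rcases le_or_gt T 0 with hT | hT
  · refine ⟨fun _ => ∫ x, ⟪w₀ x, φ x⟫_ℝ, continuousOn_const, rfl, ?_⟩
    rw [Ioo_eq_empty_of_le hT, Measure.restrict_empty, ae_zero]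
    exact eventually_bot
  -- the truncations and their representatives
  set P : ℕ → UnitAddTorus d → EuclideanSpace ℝ d := fun N => FunctionSpaces.Torus.fourierTruncate N φ with hP
  have hPs : ∀ N, FunctionSpaces.Torus.IsSmooth (P N) := fun N => FunctionSpaces.Torus.isSmooth_fourierTruncate N φ
  have hP2 : ∀ N, MemLp (P N) 2 volume := fun N => FunctionSpaces.Torus.memLp_fourierTruncate N φ 2
  choose g hgc hg0 hgae using hrep
  -- the tails
  set e : ℕ → ℝ := fun N => Real.sqrt (∫ x, ‖P N x - φ x‖ ^ 2) with he
  have he0 : Tendsto e atTop (𝓝 0) := by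
    have := (Real.continuous_sqrt.tendsto 0).comp (tendsto_integral_norm_sq_fourierTruncate_sub₉ hφ)
    rwa [Real.sqrt_zero] at this
  -- the uniform `L²` bound of the class
  obtain ⟨C, hC⟩ := h.ae_lintegral_sq_le
  have hCw : ∀ᵐ t ∂(volume.restrict (Ioo 0 T)), Real.sqrt (∫ x, ‖w t x‖ ^ 2) ≤ Real.sqrt C := by
    filter_upwards [hC, h.ae_memLp_two] with t ht ht2
    exact Real.sqrt_le_sqrt (integral_norm_sq_le_of_lintegral_le₉ ht2 ht)
  -- pairing differences are controlled by the tails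
  have hdiff : ∀ {v : UnitAddTorus d → EuclideanSpace ℝ d}, MemLp v 2 volume → ∀ N M,
      |(∫ x, ⟪v x, P N x⟫_ℝ) - ∫ x, ⟪v x, P M x⟫_ℝ| ≤ Real.sqrt (∫ x, ‖v x‖ ^ 2) * (e N + e M) := by
    intro v hv N M
    have hsN : MemLp (fun x => P N x - φ x) 2 volume := (hP2 N).sub hφ
    have hsM : MemLp (fun x => P M x - φ x) 2 volume := (hP2 M).sub hφ
    have e1 : (∫ x, ⟪v x, P N x⟫_ℝ) - ∫ x, ⟪v x, P M x⟫_ℝ =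
        (∫ x, ⟪v x, P N x - φ x⟫_ℝ) - ∫ x, ⟪v x, P M x - φ x⟫_ℝ := by
      rw [← integral_sub (integrable_inner_of_memLp_two₉ hv (hP2 N)) (integrable_inner_of_memLp_two₉ hv (hP2 M)),
        ← integral_sub (integrable_inner_of_memLp_two₉ hv hsN) (integrable_inner_of_memLp_two₉ hv hsM)]
      refine integral_congr_ae (ae_of_all _ fun x => ?_)
      simp only [inner_sub_right]
      ring
    rw [e1]
    calc |(∫ x, ⟪v x, P N x - φ x⟫_ℝ) - ∫ x, ⟪v x, P M x - φ x⟫_ℝ|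
        ≤ |∫ x, ⟪v x, P N x - φ x⟫_ℝ| + |∫ x, ⟪v x, P M x - φ x⟫_ℝ| := abs_sub _ _
      _ ≤ Real.sqrt (∫ x, ‖v x‖ ^ 2) * e N + Real.sqrt (∫ x, ‖v x‖ ^ 2) * e M :=
          add_le_add (abs_integral_inner_le_sqrt_mul_sqrt₉ hv hsN) (abs_integral_inner_le_sqrt_mul_sqrt₉ hv hsM)
      _ = Real.sqrt (∫ x, ‖v x‖ ^ 2) * (e N + e M) := by ring
  -- the representatives are Cauchy uniformly a.e.
  set a : ℕ → ℝ := fun N => Real.sqrt C * e N with ha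
  have ha0 : Tendsto a atTop (𝓝 0) := by
    have := he0.const_mul (Real.sqrt C)
    rwa [mul_zero] at this
  have hbd : ∀ N M, ∀ᵐ s ∂(volume.restrict (Ioo 0 T)), |g N s - g M s| ≤ a N + a M := by
    intro N M
    filter_upwards [hgae N, hgae M, hCw, h.ae_memLp_two] with s hN hM hs hs2
    rw [← hN, ← hM]
    calc |(∫ x, ⟪w s x, P N x⟫_ℝ) - ∫ x, ⟪w s x, P M x⟫_ℝ| ≤ Real.sqrt (∫ x, ‖w s x‖ ^ 2) * (e N + e M) :=
          hdiff hs2 N M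
      _ ≤ Real.sqrt C * (e N + e M) :=
          mul_le_mul_of_nonneg_right hs (add_nonneg (Real.sqrt_nonneg _) (Real.sqrt_nonneg _))
      _ = a N + a M := by rw [ha]; ring
  obtain ⟨G, hGc, hGlim⟩ := exists_continuousOn_tendsto_of_ae_cauchy hT hgc hbd ha0
  refine ⟨G, hGc, ?_, ?_⟩
  · -- the value at `0`
    have h0 : Tendsto (fun N => g N 0) atTop (𝓝 (G 0)) := hGlim 0 ⟨le_rfl, hT.le⟩
    have h0' : Tendsto (fun N => g N 0) atTop (𝓝 (∫ x, ⟪w₀ x, φ x⟫_ℝ)) := by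
      simp_rw [hg0]
      have hφP : ∀ N, |(∫ x, ⟪w₀ x, P N x⟫_ℝ) - ∫ x, ⟪w₀ x, φ x⟫_ℝ| ≤ Real.sqrt (∫ x, ‖w₀ x‖ ^ 2) * e N := by
        intro N
        have hsN : MemLp (fun x => P N x - φ x) 2 volume := (hP2 N).sub hφ
        rw [← integral_sub (integrable_inner_of_memLp_two₉ hw₀ (hP2 N)) (integrable_inner_of_memLp_two₉ hw₀ hφ)]
        simp_rw [← inner_sub_right]
        exact abs_integral_inner_le_sqrt_mul_sqrt₉ hw₀ hsN
      refine (tendsto_iff_norm_sub_tendsto_zero.2 ?_)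
      have hlim : Tendsto (fun N => Real.sqrt (∫ x, ‖w₀ x‖ ^ 2) * e N) atTop (𝓝 0) := by
        have := he0.const_mul (Real.sqrt (∫ x, ‖w₀ x‖ ^ 2))
        rwa [mul_zero] at this
      exact squeeze_zero (fun N => norm_nonneg _) (fun N => by rw [Real.norm_eq_abs]; exact hφP N) hlim
    exact tendsto_nhds_unique h0 h0'
  · -- the a.e. identity in the limit
    have hall := ae_all_iff.2 hgae
    filter_upwards [hall, h.ae_memLp_two, ae_restrict_mem measurableSet_Ioo] with t ht ht2 htI
    have h1 : Tendsto (fun N => g N t) atTop (𝓝 (G t)) := hGlim t ⟨htI.1.le, htI.2.le⟩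
    have h2 : Tendsto (fun N => g N t) atTop (𝓝 (∫ x, ⟪w t x, φ x⟫_ℝ)) := by
      have hφP : ∀ N, |g N t - ∫ x, ⟪w t x, φ x⟫_ℝ| ≤ Real.sqrt (∫ x, ‖w t x‖ ^ 2) * e N := by
        intro N
        have hsN : MemLp (fun x => P N x - φ x) 2 volume := (hP2 N).sub hφ
        rw [← ht N, ← integral_sub (integrable_inner_of_memLp_two₉ ht2 (hP2 N)) (integrable_inner_of_memLp_two₉ ht2 hφ)]
        simp_rw [← inner_sub_right]
        exact abs_integral_inner_le_sqrt_mul_sqrt₉ ht2 hsN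
      refine (tendsto_iff_norm_sub_tendsto_zero.2 ?_)
      have hlim : Tendsto (fun N => Real.sqrt (∫ x, ‖w t x‖ ^ 2) * e N) atTop (𝓝 0) := by
        have := he0.const_mul (Real.sqrt (∫ x, ‖w t x‖ ^ 2))
        rwa [mul_zero] at this
      exact squeeze_zero (fun N => norm_nonneg _) (fun N => by rw [Real.norm_eq_abs]; exact hφP N) hlim
    exact (tendsto_nhds_unique h1 h2).symm

/-- **Continuous representative of the pairing with a weakly divergence-free `L²` test (weak
`L²`-continuity in time).** For a weak tensor-viscosity passive-vector solution with datum
`w₀ ∈ L²` and every weakly divergence-free `φ ∈ L²(T^d; ℝ^d)` there is `g : ℝ → ℝ`, continuous on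
`[0,T]`, with `g(0) = ∫⟪w₀, φ⟫` and `∫⟪w(t), φ⟫ = g(t)` for a.e. `t ∈ (0,T)`.
Proof: the truncations `P_N φ` are smooth and divergence free and `P_N φ → φ` in `L²`; their
representatives `g_N` (`exists_continuousOn_integral_inner_of_isSmooth`) satisfy
`|g_N − g_M| ≤ C(‖P_Nφ − φ‖₂ + ‖P_Mφ − φ‖₂)` a.e., hence everywhere on `[0,T]` by continuity, so
they converge uniformly to a continuous `g`; the a.e. identities pass to the limit.
[cite: Temam1984, Ch. III §1 Lemma 1.4] [cite: DeLellisSzekelyhidi2010, Lemma 7.1] -/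
theorem exists_continuousOn_integral_inner (h : IsWeakTensorPassiveVectorOn A T 𝔸 b w₀ w)
    (hw₀ : MemLp w₀ 2 volume) {φ : UnitAddTorus d → EuclideanSpace ℝ d} (hφ : MemLp φ 2 volume)
    (hφdiv : FunctionSpaces.Torus.IsWeaklyDivFree φ) :
    ∃ g : ℝ → ℝ, ContinuousOn g (Icc 0 T) ∧ g 0 = ∫ x, ⟪w₀ x, φ x⟫_ℝ ∧
      ∀ᵐ t ∂(volume.restrict (Ioo 0 T)), ∫ x, ⟪w t x, φ x⟫_ℝ = g t :=
  h.exists_continuousOn_integral_inner_of_forall_fourierTruncate hw₀ hφ fun N =>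
    h.exists_continuousOn_integral_inner_of_isSmooth (FunctionSpaces.Torus.isSmooth_fourierTruncate N φ)
      (FunctionSpaces.Torus.isDivFree_fourierTruncate hφ hφdiv N)

/-! ## The strong `L²` initial trace -/

/-- **Strong right-continuity at `t = 0` in `L²`, modulus form.** If a weak tensor-viscosity
passive-vector solution with a weakly divergence-free datum `w₀ ∈ L²` satisfies the energy
inequality `∫‖w(t)‖² ≤ ∫‖w₀‖²` for a.e. `t ∈ (0,T)`, then there is `ω : ℝ → ℝ`, continuous on
`[0,T]` with `ω(0) = 0`, such that `∫‖w(t) − w₀‖² ≤ ω(t)` for a.e. `t ∈ (0,T)`: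
`‖w(t) − w₀‖² = ‖w(t)‖² − 2⟪w(t), w₀⟫ + ‖w₀‖² ≤ 2(‖w₀‖² − g(t)) =: ω(t)` with `g` the continuous
representative of `t ↦ ∫⟪w(t), w₀⟫`, `g(0) = ‖w₀‖²`. [cite: Temam1984, Ch. III §1, proof of Thm. 1.1, (1.61)–(1.63)] -/
theorem exists_modulus_integral_norm_sq_sub (h : IsWeakTensorPassiveVectorOn A T 𝔸 b w₀ w)
    (hw₀ : MemLp w₀ 2 volume) (hdiv₀ : FunctionSpaces.Torus.IsWeaklyDivFree w₀)
    (hE : ∀ᵐ t ∂(volume.restrict (Ioo 0 T)), ∫ x, ‖w t x‖ ^ 2 ≤ ∫ x, ‖w₀ x‖ ^ 2) :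
    ∃ ω : ℝ → ℝ, ContinuousOn ω (Icc 0 T) ∧ ω 0 = 0 ∧
      ∀ᵐ t ∂(volume.restrict (Ioo 0 T)), ∫ x, ‖w t x - w₀ x‖ ^ 2 ≤ ω t := by
  obtain ⟨g, hgc, hg0, hg⟩ := h.exists_continuousOn_integral_inner hw₀ hw₀ hdiv₀
  refine ⟨fun t => 2 * ((∫ x, ‖w₀ x‖ ^ 2) - g t), continuousOn_const.mul (continuousOn_const.sub hgc), ?_, ?_⟩
  · simp only [hg0, real_inner_self_eq_norm_sq, sub_self, mul_zero]
  · filter_upwards [hg, hE, h.ae_memLp_two] with t ht htE ht2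
    have i1 : Integrable (fun x => ‖w t x‖ ^ 2) volume := ht2.integrable_norm_pow two_ne_zero
    have i2 : Integrable (fun x => ⟪w t x, w₀ x⟫_ℝ) volume := integrable_inner_of_memLp_two₉ ht2 hw₀
    have i3 : Integrable (fun x => ‖w₀ x‖ ^ 2) volume := hw₀.integrable_norm_pow two_ne_zero
    have hexp : ∫ x, ‖w t x - w₀ x‖ ^ 2 = (∫ x, ‖w t x‖ ^ 2) - 2 * (∫ x, ⟪w t x, w₀ x⟫_ℝ) + ∫ x, ‖w₀ x‖ ^ 2 := by
      have : ∀ x, ‖w t x - w₀ x‖ ^ 2 = ‖w t x‖ ^ 2 - 2 * ⟪w t x, w₀ x⟫_ℝ + ‖w₀ x‖ ^ 2 := fun x =>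
        norm_sub_sq_real _ _
      simp_rw [this]
      rw [integral_add (i1.sub' (i2.const_mul 2)) i3, integral_sub i1 (i2.const_mul 2), integral_const_mul]
    rw [hexp, ht]
    linarith

/-- **Strong right-continuity at `t = 0` in `L²`, `ε`–`δ` form**: under the energy inequality and for
a weakly divergence-free `L²` datum, for every `ε > 0` there is `δ > 0` with `∫‖w(t) − w₀‖² ≤ ε` for
a.e. `t ∈ (0,T)` with `t < δ`. [cite: Temam1984, Ch. III §1, proof of Thm. 1.1, (1.61)–(1.63)] -/
theorem forall_eps_ae_integral_norm_sq_sub_le (h : IsWeakTensorPassiveVectorOn A T 𝔸 b w₀ w)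
    (hw₀ : MemLp w₀ 2 volume) (hdiv₀ : FunctionSpaces.Torus.IsWeaklyDivFree w₀)
    (hE : ∀ᵐ t ∂(volume.restrict (Ioo 0 T)), ∫ x, ‖w t x‖ ^ 2 ≤ ∫ x, ‖w₀ x‖ ^ 2) :
    ∀ ε > 0, ∃ δ > 0, ∀ᵐ t ∂(volume.restrict (Ioo 0 T)), t < δ → ∫ x, ‖w t x - w₀ x‖ ^ 2 ≤ ε := by
  intro ε hε
  rcases le_or_gt T 0 with hT | hT
  · refine ⟨1, one_pos, ?_⟩
    rw [Ioo_eq_empty_of_le hT, Measure.restrict_empty, ae_zero]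
    exact eventually_bot
  obtain ⟨ω, hωc, hω0, hω⟩ := h.exists_modulus_integral_norm_sq_sub hw₀ hdiv₀ hE
  have hcont : ContinuousWithinAt ω (Icc 0 T) 0 := hωc 0 ⟨le_rfl, hT.le⟩
  obtain ⟨δ, hδ, hδε⟩ := Metric.continuousWithinAt_iff.1 hcont ε hε
  refine ⟨δ, hδ, ?_⟩
  filter_upwards [hω, ae_restrict_mem measurableSet_Ioo] with t ht htI htδ
  have hd : dist t 0 < δ := by rw [dist_zero_right, Real.norm_eq_abs, abs_of_pos htI.1]; exact htδ
  have := hδε ⟨htI.1.le, htI.2.le⟩ hd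
  rw [hω0, dist_zero_right, Real.norm_eq_abs] at this
  exact ht.trans ((le_abs_self _).trans this.le)

/-! ## `A = 0`, coercive tensor, bounded carrier: the energy inequality is automatic -/

/-- The energy inequality in real form: for `A = 0`, `NearIso 𝔸 lo hi` with `0 < lo`,
`stLift b ∈ L^∞((0,T) × T^d)` and a weakly divergence-free `L²` datum, `∫‖w(t)‖² ≤ ∫‖w₀‖²` for a.e.
`t ∈ (0,T)` (`PassiveVectorTensorEnergyDecay.ae_energy_ineq`, dropping the dissipation).
[cite: Temam1984, Ch. III §1 Lemma 1.2] -/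
theorem ae_integral_norm_sq_le (h : IsWeakTensorPassiveVectorOn 0 T 𝔸 b w₀ w)
    {lo hi : ℝ} (h𝔸 : NearIso 𝔸 lo hi) (hlo : 0 < lo)
    (hw₀ : MemLp w₀ 2 volume) (hdiv₀ : FunctionSpaces.Torus.IsWeaklyDivFree w₀)
    (hb : MemLp (FunctionSpaces.Torus.stLift b) ∞ (volume.restrict (Ioo 0 T ×ˢ univ))) :
    ∀ᵐ t ∂(volume.restrict (Ioo 0 T)), ∫ x, ‖w t x‖ ^ 2 ≤ ∫ x, ‖w₀ x‖ ^ 2 := by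
  filter_upwards [h.ae_energy_ineq h𝔸 hlo hw₀ hdiv₀ hb] with t ht
  have h1 : ENNReal.ofReal (∫ x, ‖w t x‖ ^ 2) ≤ ENNReal.ofReal (∫ x, ‖w₀ x‖ ^ 2) := le_trans le_self_add ht
  exact (ENNReal.ofReal_le_ofReal_iff (integral_nonneg fun x => sq_nonneg _)).1 h1

/-- **Strong `L²` initial trace of EVERY weak solution, modulus form** (`A = 0`, `NearIso 𝔸 lo hi`
with `0 < lo`, bounded carrier, weakly divergence-free `L²` datum): there is `ω` continuous on
`[0,T]` with `ω(0) = 0` and `∫‖w(t) − w₀‖² ≤ ω(t)` for a.e. `t ∈ (0,T)`.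
[cite: Temam1984, Ch. III §1, proof of Thm. 1.1, (1.61)–(1.63)] -/
theorem exists_modulus_integral_norm_sq_sub_of_nearIso (h : IsWeakTensorPassiveVectorOn 0 T 𝔸 b w₀ w)
    {lo hi : ℝ} (h𝔸 : NearIso 𝔸 lo hi) (hlo : 0 < lo)
    (hw₀ : MemLp w₀ 2 volume) (hdiv₀ : FunctionSpaces.Torus.IsWeaklyDivFree w₀)
    (hb : MemLp (FunctionSpaces.Torus.stLift b) ∞ (volume.restrict (Ioo 0 T ×ˢ univ))) :
    ∃ ω : ℝ → ℝ, ContinuousOn ω (Icc 0 T) ∧ ω 0 = 0 ∧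
      ∀ᵐ t ∂(volume.restrict (Ioo 0 T)), ∫ x, ‖w t x - w₀ x‖ ^ 2 ≤ ω t :=
  h.exists_modulus_integral_norm_sq_sub hw₀ hdiv₀ (h.ae_integral_norm_sq_le h𝔸 hlo hw₀ hdiv₀ hb)

/-- **Strong `L²` initial trace of EVERY weak solution, `ε`–`δ` form** (`A = 0`, `NearIso 𝔸 lo hi`
with `0 < lo`, bounded carrier, weakly divergence-free `L²` datum): for every `ε > 0` there is
`δ > 0` with `∫‖w(t) − w₀‖² ≤ ε` for a.e. `t ∈ (0,T)`, `t < δ`.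
[cite: Temam1984, Ch. III §1, proof of Thm. 1.1, (1.61)–(1.63)] -/
theorem forall_eps_ae_integral_norm_sq_sub_le_of_nearIso (h : IsWeakTensorPassiveVectorOn 0 T 𝔸 b w₀ w)
    {lo hi : ℝ} (h𝔸 : NearIso 𝔸 lo hi) (hlo : 0 < lo)
    (hw₀ : MemLp w₀ 2 volume) (hdiv₀ : FunctionSpaces.Torus.IsWeaklyDivFree w₀)
    (hb : MemLp (FunctionSpaces.Torus.stLift b) ∞ (volume.restrict (Ioo 0 T ×ˢ univ))) :
    ∀ ε > 0, ∃ δ > 0, ∀ᵐ t ∂(volume.restrict (Ioo 0 T)), t < δ → ∫ x, ‖w t x - w₀ x‖ ^ 2 ≤ ε :=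
  h.forall_eps_ae_integral_norm_sq_sub_le hw₀ hdiv₀ (h.ae_integral_norm_sq_le h𝔸 hlo hw₀ hdiv₀ hb)

/-! ## Amendment 1: arbitrary (not necessarily divergence-free) tests, divergence-free datum -/

/-- **Continuous representative of the pairing with an ARBITRARY smooth steady field**, for a
weakly divergence-free integrable datum: there is `g` continuous on `[0,T]` with
`g(0) = ∫⟪w₀, G⟫` and `∫⟪w(t), G⟫ = g(t)` for a.e. `t ∈ (0,T)`. Write `G = G₁ + ∇φ₁` with `G₁`
smooth divergence free (smooth Helmholtz–Weyl decomposition); the gradient part pairs to zero with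
`w(t)` for a.e. `t` and with `w₀` (both weakly divergence free), so the representative of
`exists_continuousOn_integral_inner_of_isSmooth` for `G₁` serves.
[cite: Temam1984, Ch. III §1 Lemma 1.1 and (1.61)] [cite: RobinsonRodrigoSadowski2016, Thm. 2.6 (ii)] -/
theorem exists_continuousOn_integral_inner_of_isSmooth' (h : IsWeakTensorPassiveVectorOn A T 𝔸 b w₀ w)
    (hw₀ : Integrable w₀ volume) (hdiv₀ : FunctionSpaces.Torus.IsWeaklyDivFree w₀)
    {G : UnitAddTorus d → EuclideanSpace ℝ d} (hG : FunctionSpaces.Torus.IsSmooth G) :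
    ∃ g : ℝ → ℝ, ContinuousOn g (Icc 0 T) ∧ g 0 = ∫ x, ⟪w₀ x, G x⟫_ℝ ∧
      ∀ᵐ t ∂(volume.restrict (Ioo 0 T)), ∫ x, ⟪w t x, G x⟫_ℝ = g t := by
  obtain ⟨G₁, φ₁, hG₁, hφ₁, hdiv₁, -, hdec⟩ := FunctionSpaces.Torus.smooth_helmholtz_holds d G hG
  obtain ⟨g, hgc, hg0, hg⟩ := h.exists_continuousOn_integral_inner_of_isSmooth hG₁ hdiv₁
  -- splitting of the pairings along `G = G₁ + ∇φ₁`
  have hsplit : ∀ {v : UnitAddTorus d → EuclideanSpace ℝ d}, Integrable v volume →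
      FunctionSpaces.Torus.IsWeaklyDivFree v → ∫ x, ⟪v x, G x⟫_ℝ = ∫ x, ⟪v x, G₁ x⟫_ℝ := by
    intro v hv hvdiv
    have i1 : Integrable (fun x => ⟪v x, G₁ x⟫_ℝ) volume :=
      FunctionSpaces.Torus.integrable_inner_of_continuous hv hG₁.continuous
    have i2 : Integrable (fun x => ⟪v x, FunctionSpaces.Torus.gradient φ₁ x⟫_ℝ) volume :=
      FunctionSpaces.Torus.integrable_inner_of_continuous hv hφ₁.gradient.continuous
    have e : ∀ x, ⟪v x, G x⟫_ℝ = ⟪v x, G₁ x⟫_ℝ + ⟪v x, FunctionSpaces.Torus.gradient φ₁ x⟫_ℝ := fun x => by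
      rw [hdec x, inner_add_right]
    simp_rw [e]
    rw [integral_add i1 i2, hvdiv φ₁ hφ₁, add_zero]
  refine ⟨g, hgc, ?_, ?_⟩
  · rw [hg0, hsplit hw₀ hdiv₀]
  · filter_upwards [hg, h.ae_isWeaklyDivFree, h.ae_integrable_slice] with t ht hdivt hint
    rw [hsplit hint.1 hdivt, ht]

/-- **Weak `L²`-continuity in time against ALL of `L²`**: for a weak tensor-viscosity passive-vector
solution with a weakly divergence-free datum `w₀ ∈ L²` and every `φ ∈ L²(T^d; ℝ^d)` (NOT necessarily
divergence free) there is `g : ℝ → ℝ`, continuous on `[0,T]`, with `g(0) = ∫⟪w₀, φ⟫` and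
`∫⟪w(t), φ⟫ = g(t)` for a.e. `t ∈ (0,T)` (density of the truncations `P_N φ`, which are smooth, and
the uniform `L²` bound, exactly as `exists_continuousOn_integral_inner`, now through
`exists_continuousOn_integral_inner_of_isSmooth'`). [cite: Temam1984, Ch. III §1 Lemma 1.4]
[cite: DeLellisSzekelyhidi2010, Lemma 7.1] -/
theorem exists_continuousOn_integral_inner_of_memLp (h : IsWeakTensorPassiveVectorOn A T 𝔸 b w₀ w)
    (hw₀ : MemLp w₀ 2 volume) (hdiv₀ : FunctionSpaces.Torus.IsWeaklyDivFree w₀)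
    {φ : UnitAddTorus d → EuclideanSpace ℝ d} (hφ : MemLp φ 2 volume) :
    ∃ g : ℝ → ℝ, ContinuousOn g (Icc 0 T) ∧ g 0 = ∫ x, ⟪w₀ x, φ x⟫_ℝ ∧
      ∀ᵐ t ∂(volume.restrict (Ioo 0 T)), ∫ x, ⟪w t x, φ x⟫_ℝ = g t :=
  h.exists_continuousOn_integral_inner_of_forall_fourierTruncate hw₀ hφ fun N =>
    h.exists_continuousOn_integral_inner_of_isSmooth' (hw₀.integrable one_le_two) hdiv₀
      (FunctionSpaces.Torus.isSmooth_fourierTruncate N φ)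

/-- **Every Fourier coefficient of a weak solution has a continuous representative** taking the
datum's coefficient at `t = 0`: for a weakly divergence-free datum `w₀ ∈ L²`, every `k ∈ ℤ^d` and
`z ∈ ℂ^d` there is `g : ℝ → ℂ`, continuous on `[0,T]`, with `g(0) = ⟪ŵ₀(k), z⟫` and
`⟪ŵ(t)(k), z⟫ = g(t)` for a.e. `t` (pair with the two real single modes `Re(e_k • z)`, `Re(e_k • iz)`,
which need not be divergence free). [cite: Temam1984, Ch. III §1 Lemma 1.4] -/
theorem exists_continuousOn_inner_mFourierCoeff (h : IsWeakTensorPassiveVectorOn A T 𝔸 b w₀ w)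
    (hw₀ : MemLp w₀ 2 volume) (hdiv₀ : FunctionSpaces.Torus.IsWeaklyDivFree w₀) (k : d → ℤ) (z : EuclideanSpace ℂ d) :
    ∃ g : ℝ → ℂ, ContinuousOn g (Icc 0 T) ∧
      g 0 = ⟪mFourierCoeff (FunctionSpaces.EuclideanSpace.complexify ∘ w₀) k, z⟫_ℂ ∧
      ∀ᵐ t ∂(volume.restrict (Ioo 0 T)),
        ⟪mFourierCoeff (FunctionSpaces.EuclideanSpace.complexify ∘ w t) k, z⟫_ℂ = g t := by
  have hw₀i : Integrable w₀ volume := hw₀.integrable one_le_two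
  -- the two real single-mode tests
  obtain ⟨g₁, hg₁c, hg₁0, hg₁⟩ := h.exists_continuousOn_integral_inner_of_isSmooth' hw₀i hdiv₀
    (FunctionSpaces.Torus.isSmooth_realTrigPoly {k} (fun _ => z))
  obtain ⟨g₂, hg₂c, hg₂0, hg₂⟩ := h.exists_continuousOn_integral_inner_of_isSmooth' hw₀i hdiv₀
    (FunctionSpaces.Torus.isSmooth_realTrigPoly {k} (fun _ => I • z))
  refine ⟨fun t => ((g₁ t : ℝ) : ℂ) - I * ((g₂ t : ℝ) : ℂ), ?_, ?_, ?_⟩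
  · exact (Complex.continuous_ofReal.comp_continuousOn hg₁c).sub
      (continuousOn_const.mul (Complex.continuous_ofReal.comp_continuousOn hg₂c))
  · have e1 := FunctionSpaces.Torus.integral_inner_realTrigPoly_singleton hw₀i k (fun _ => z)
    have e2 := FunctionSpaces.Torus.integral_inner_realTrigPoly_singleton hw₀i k (fun _ => I • z)
    show ((g₁ 0 : ℝ) : ℂ) - I * ((g₂ 0 : ℝ) : ℂ) = _
    rw [hg₁0, hg₂0, e1, e2, inner_smul_right]
    apply Complex.ext
    · simp
    · simp
  · filter_upwards [hg₁, hg₂, h.ae_integrable_slice] with t h1 h2 hint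
    have e1 := FunctionSpaces.Torus.integral_inner_realTrigPoly_singleton hint.1 k (fun _ => z)
    have e2 := FunctionSpaces.Torus.integral_inner_realTrigPoly_singleton hint.1 k (fun _ => I • z)
    show _ = ((g₁ t : ℝ) : ℂ) - I * ((g₂ t : ℝ) : ℂ)
    rw [← h1, ← h2, e1, e2, inner_smul_right]
    apply Complex.ext
    · simp
    · simp

end IsWeakTensorPassiveVectorOn

end Torus

end Literature.Analysis.FluidPDE

end
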